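import Literature.AnabelianGeometry.EtaleTheta.Discharge.Sec5Thm510
import Literature.AnabelianGeometry.EtaleTheta.Discharge.Sec5Thm510iiiKummerPart
import Literature.AnabelianGeometry.EtaleTheta.Discharge.Sec5KummerGaloisDictionaryTransfers

/-!
# [EtTh] §5, Theorem 5.10 (iii) at the nonempty `K^×`-part `DK := kummerOut`, BY NAME from the Galois dictionary (pp. 332–335 / PDF pp. 106–109)

Mochizuki, *The étale theta function and its Frobenioid-theoretic manifestations*, Publ. RIMS **45**
(2009) [cite: MochizukiEtTh2009, Thm 5.10 (iii) p.334 (PDF p.108)]; Lemma 5.9 (iv) p.332 (PDF p.106); Def. 2.13 (i)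
p.273 (PDF p.47).  Layer L2 of the abc-iut cell, seat abc-iut-L2-t11 (gen 4); GAP-LEDGER row **G-L2lead-1** (`hDK`),
abc-iut-L2-lead (gen 3) chair GO 2026-08-26T08:23:21Z, second half: "wire the nonempty `DK₀ := kummerOut` … from
your Galois dictionary (datum + membership laws) AND prove `γ`-stability".  PROOF-ONLY (0 defs; nothing landed is
edited).  Companion of `Discharge/Sec5Thm510iiiKummerOut.lean` (the INTRINSIC route, via a birational companion).

WHAT IS PROVED.  The `hDK` binder of abc-iut-L2-d4's `exists_monoThetaIso_of_psiAutPreserves`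
(`Discharge/Sec5Thm510iii.lean`; "`γ` maps the remaining Kummer part `DK` of `D` into `D`", for EVERY compatible pair
`(Φ, ψ)`) VERBATIM at `DK := kummerOut` = this seat's intrinsic `K^×`-part (`FrobenioidKummerOut.lean`: the classes
of "conjugation by `f ∈ (K^×)^{1/N}`", Lemma 5.8 / Lemma 5.9 (iv) "the natural outer actions of `l·ℤ`, `K^×`"), from
three landed ingredients BY NAME: (1) `kummerOut ⊆ DK₀ := (E^Π_N ⥲ Π^tp_Y[μ_N])⁻¹(kummerOut(D_Y))` — the Kummer
cocycle of an `N`-th root of a constant is inflated from `G_K` (gen 2 `kummerOut_subset_preimage`, gen 3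
`hinfl_of_geometric ∘ hgeom_of_galoisDictionary`); (2) abc-iut-L6-t23's `transport_envAut_mem_kummerPart`
(`Discharge/Sec5Thm510iiiKummerPart.lean`): `γ = (Φ, ψ)|_{E^Π_N}` maps `DK₀` into itself whenever `ψ` preserves
`Π^tp_Y̲ ∩ Ker(Π^tp_X̲ ↠ G_K)` — a clause of [EtTh] Cor. 2.18 (i) (`aug_iff_of_cor218_i`, abc-iut-L2-t2's
`RigidData.Cor218_i`); (3) gen 3's `D_kummerOut_eq_of_galoisDictionary` (`Discharge/Sec5KummerGaloisDictionary.lean`):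
`D(kummerOut) = D(DK₀)` — every class of `DK₀` is reached from `(K^×)^{1/N}` (Hilbert 90 over `K`,
abc-iut-w5-d234's `AlgEquiv.exists_kummer_eq_of_isOpen`).  RESULTS: `transport_envAut_mem_D_kummerOut_of_galoisDictionary`
(any `T : ThetaEnvData`, clause `hΔ` explicit), `hDK_kummerOut_of_cor218_i_of_galoisDictionary` (over abc-iut-L2-t2's
`R : RigidData`, `hΔ` from Cor. 2.18 (i)), `exists_monoThetaIso_of_psiAutPreserves_kummerOut_of_galoisDictionary`,
`monoThetaEnvCompat_kummerOut_of_cor218_i_of_galoisDictionary` — Theorem 5.10 (iii) (unfolded / as abc-iut-L2-t4's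
`MonoThetaEnvCompat`) at the SAME nonempty object `frdMonoThetaEnv … (kummerOut)` at which this seat's
`frdIsMonoThetaEnv_birat_of_galoisDictionary` certifies Lemma 5.9 (iv) "In particular" (the [IUTchII] Prop. 1.2 (ii)
binder `hM`).  Hypotheses, all named in the signatures: the §5 named inputs, `KxRootNModCyclotome`, the natural action
`α` (`BiratAutAction`), the identifications `ι`, `m`, `IdentifiesPiY`, the Galois dictionary of the constants
(`e`, `j`, `ν` with `hj`, `hjN`, `hchi`, `hνμ`, `hνeq`, `hνN`, `haugY`, `hopen`), Theorem 5.10 (ii) as typed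
(`PsiAutPreserves`) with the representative `ψY`, and Cor. 2.18 (i).
HONEST FRAMING: kernel-checked compositions of landed theorems over the typed §5/§2 interfaces; nothing of [EtTh] is
asserted unconditionally; typed ≠ proved; no side is taken on anything downstream ([IUTchIII] Cor. 3.12).
-/

namespace Literature.AnabelianGeometry.EtaleTheta

open CategoryTheory
open scoped Pointwise

universe w v v' u u'

namespace ThetaFrobenioid

variable {C : Type u} [Category.{v} C] {D : Type u'} [Category.{v'} D] {𝔉 : ThetaFrobenioid.{w} C D}

namespace BiratAutAction

section Dictionary

variable (α : 𝔉.BiratAutAction) (hK : 𝔉.KxRootNModCyclotome) (h1 : 𝔉.SectionsFactor)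
  (h3 : 𝔉.OuterActionLZ) (hsec : 𝔉.SgpCapSection) (hcs : 𝔉.SgpCupSection) (h8 : 𝔉.ConstantsEqNormalizer)
  (T : ThetaEnvData.{v} 𝔉.N) (ι : 𝔉.PiX ≃ₜ* T.PiX) (m : 𝔉.muTorsion 𝔉.BN 𝔉.N ≃* T.mu)
  {F : Type*} {L : Type*} [Field F] [Field L] [Algebra F L]
  (e : T.G ≃* (L ≃ₐ[F] L)) (j : T.mu →* Lˣ) (ν : 𝔉.KxRootN →* Lˣ)

/-- **`hDK` at `DK := kummerOut` FROM THE GALOIS DICTIONARY**, for EVERY compatible pair `(Φ, ψ)` with `ψ`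
preserving `Π^tp_Y̲ ∩ Ker(Π^tp_X̲ ↠ G_K)` (`hΔ`): `kummerOut ⊆ DK₀` (the Kummer cocycles of the roots of constants are
inflated from `G_K`: `hgeom_of_galoisDictionary`), `γ` maps `DK₀` into itself (abc-iut-L6-t23's
`transport_envAut_mem_kummerPart`), and `D(kummerOut) = D(DK₀)` (`D_kummerOut_eq_of_galoisDictionary`: every class
in `DK₀` is reached from `(K^×)^{1/N}` by Hilbert 90 over `K`).  Print: "`Ψ^birat_Aut` … preserve[s] `(K^×)^{1/N}`"
read through "the image of `K^× → H¹(G_K, μ_N) → Out(Π^tp_Y[μ_N])`" (Def. 2.13 (i)).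
[cite: MochizukiEtTh2009, Thm 5.10 (iii) p.334 (PDF p.108); Lem 5.9 (iv) p.332 (PDF p.106)] -/
theorem transport_envAut_mem_D_kummerOut_of_galoisDictionary [Normal F L] [NeZero ((𝔉.N : ℕ) : F)]
    (H : 𝔉.Facts) (hY : 𝔉.IdentifiesPiY T ι.toMulEquiv) (hj : Function.Injective j) (hjN : ∀ z : Lˣ, z ^ (𝔉.N : ℕ) = 1 → z ∈ j.range)
    (hchi : ∀ (g : T.G) (x : T.mu), j (T.chi g x) = e g • j x)
    (hνμ : ∀ u : 𝔉.muTorsion 𝔉.BN 𝔉.N, ν ⟨𝔉.muToBirat u, 𝔉.muToBirat_mem_KxRootN u⟩ = j (m u))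
    (hνeq : ∀ (f : 𝔉.KxRootN) (y : 𝔉.PiX),
      j (m (α.kummerCocycle hK f (𝔉.sgpCap (𝔉.ρ y)))) * ν f = e (T.aug (ι y)) • ν f)
    (hνN : ∀ y : Fˣ, ∃ f : 𝔉.KxRootN, ((ν f : Lˣ) : L) ^ (𝔉.N : ℕ) = algebraMap F L y)
    (haugY : Function.Surjective T.augY) (hopen : IsOpenMap fun p : T.PiY => e (T.augY p))
    {Φ : Aut 𝔉.BN ≃* Aut 𝔉.BN} {ψ : 𝔉.PiX ≃ₜ* 𝔉.PiX} (hc : 𝔉.IsEnvCompatible Φ ψ)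
    (hΔ : ∀ y ∈ 𝔉.PiY, T.aug (ι (ψ y)) = 1 ↔ T.aug (ι y) = 1)
    {d : TopOut 𝔉.EPiN} (hd : d ∈ α.kummerOut hK) :
    TopOut.transport (𝔉.envAut (hc.stabilizesEPiN hsec)) d ∈
      (𝔉.frdMonoThetaEnv h1 h3 hsec hcs h8 (α.kummerOut hK)).D := by
  have hχ : 𝔉.CyclotomicCharacterCompat T ι.toMulEquiv m :=
    (α.cyclotomicCharacterCompatX_of_galoisDictionary hK T ι m e j ν hj hchi hνμ hνeq).toY
  have hsub : α.kummerOut hK ⊆ TopOut.transport (𝔉.envContIso H T ι m hY hχ) ⁻¹' T.kummerOut :=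
    α.kummerOut_subset_preimage hK H T ι m hY hχ
      (α.hinfl_of_geometric hK T ι m (α.hgeom_of_galoisDictionary hK T ι m e j ν hj hνeq))
  have h0 := 𝔉.transport_envAut_mem_kummerPart H hsec T ι m hY hχ hc hΔ (hsub hd)
  change _ ∈ (𝔉.frdBiThetaEnv h1 h3 hsec hcs h8 (α.kummerOut hK)).D
  rw [α.D_kummerOut_eq_of_galoisDictionary hK H h1 h3 hsec hcs h8 T ι m hY e j ν hj hjN hchi hνμ hνeq hνN
    haugY hopen]
  exact Subgroup.subset_closure (Or.inr h0)

end Dictionary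

section DictionaryCor218

variable (α : 𝔉.BiratAutAction) (hK : 𝔉.KxRootNModCyclotome) (h1 : 𝔉.SectionsFactor)
  (h3 : 𝔉.OuterActionLZ) (hsec : 𝔉.SgpCapSection) (hcs : 𝔉.SgpCupSection) (h8 : 𝔉.ConstantsEqNormalizer)
  {l : ℕ} (R : RigidData.{v} 𝔉.N l) (ι : 𝔉.PiX ≃ₜ* R.PiX) (m : 𝔉.muTorsion 𝔉.BN 𝔉.N ≃* R.mu)
  {F : Type*} {L : Type*} [Field F] [Field L] [Algebra F L]
  (e : R.G ≃* (L ≃ₐ[F] L)) (j : R.mu →* Lˣ) (ν : 𝔉.KxRootN →* Lˣ)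

/-- **The `hDK` binder of abc-iut-L2-d4's `exists_monoThetaIso_of_psiAutPreserves` VERBATIM at `DK := kummerOut`**
(for every compatible pair, no `hΔ` left), over abc-iut-L2-t2's §2 model data `R : RigidData`, FROM THE GALOIS
DICTIONARY and [EtTh] Cor. 2.18 (i) BY NAME (`R.Cor218_i` ⇒ `hΔ`, abc-iut-L6-t23's `aug_iff_of_cor218_i`).
[cite: MochizukiEtTh2009, Thm 5.10 (iii) p.334 (PDF p.108); Cor 2.18 (i) p.286 (PDF p.60)] -/
theorem hDK_kummerOut_of_cor218_i_of_galoisDictionary [Normal F L] [NeZero ((𝔉.N : ℕ) : F)]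
    (H : 𝔉.Facts)
    (hY : 𝔉.IdentifiesPiY R.toThetaEnvData ι.toMulEquiv) (h218 : R.Cor218_i) (hj : Function.Injective j) (hjN : ∀ z : Lˣ, z ^ (𝔉.N : ℕ) = 1 → z ∈ j.range)
    (hchi : ∀ (g : R.G) (x : R.mu), j (R.chi g x) = e g • j x)
    (hνμ : ∀ u : 𝔉.muTorsion 𝔉.BN 𝔉.N, ν ⟨𝔉.muToBirat u, 𝔉.muToBirat_mem_KxRootN u⟩ = j (m u))
    (hνeq : ∀ (f : 𝔉.KxRootN) (y : 𝔉.PiX),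
      j (m (α.kummerCocycle hK f (𝔉.sgpCap (𝔉.ρ y)))) * ν f = e (R.aug (ι y)) • ν f)
    (hνN : ∀ y : Fˣ, ∃ f : 𝔉.KxRootN, ((ν f : Lˣ) : L) ^ (𝔉.N : ℕ) = algebraMap F L y)
    (haugY : Function.Surjective R.toThetaEnvData.augY)
    (hopen : IsOpenMap fun p : R.toThetaEnvData.PiY => e (R.toThetaEnvData.augY p))
    {Φ : Aut 𝔉.BN ≃* Aut 𝔉.BN} {ψ : 𝔉.PiX ≃ₜ* 𝔉.PiX} (hc : 𝔉.IsEnvCompatible Φ ψ) :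
    ∀ d ∈ α.kummerOut hK, TopOut.transport (𝔉.envAut (hc.stabilizesEPiN hsec)) d ∈
      (𝔉.frdMonoThetaEnv h1 h3 hsec hcs h8 (α.kummerOut hK)).D :=
  fun _ hd => α.transport_envAut_mem_D_kummerOut_of_galoisDictionary hK h1 h3 hsec hcs h8 R.toThetaEnvData ι
    m e j ν H hY hj hjN hchi hνμ hνeq hνN haugY hopen hc (𝔉.aug_iff_of_cor218_i R ι h218 ψ) hd

/-- **[EtTh] Theorem 5.10 (iii) (unfolded) at `DK := kummerOut` FROM THE GALOIS DICTIONARY**: abc-iut-L2-d4's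
`exists_monoThetaIso_of_psiAutPreserves` with its `hDK` binder DISCHARGED by
`hDK_kummerOut_of_cor218_i_of_galoisDictionary`.  [cite: MochizukiEtTh2009, Thm 5.10 (iii) p.334–335 (PDF pp.108–109)] -/
theorem exists_monoThetaIso_of_psiAutPreserves_kummerOut_of_galoisDictionary [Normal F L]
    [NeZero ((𝔉.N : ℕ) : F)] (H : 𝔉.Facts)
    (hY : 𝔉.IdentifiesPiY R.toThetaEnvData ι.toMulEquiv) (h218 : R.Cor218_i) (hj : Function.Injective j)
    (hjN : ∀ z : Lˣ, z ^ (𝔉.N : ℕ) = 1 → z ∈ j.range)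
    (hchi : ∀ (g : R.G) (x : R.mu), j (R.chi g x) = e g • j x)
    (hνμ : ∀ u : 𝔉.muTorsion 𝔉.BN 𝔉.N, ν ⟨𝔉.muToBirat u, 𝔉.muToBirat_mem_KxRootN u⟩ = j (m u))
    (hνeq : ∀ (f : 𝔉.KxRootN) (y : 𝔉.PiX),
      j (m (α.kummerCocycle hK f (𝔉.sgpCap (𝔉.ρ y)))) * ν f = e (R.aug (ι y)) • ν f)
    (hνN : ∀ y : Fˣ, ∃ f : 𝔉.KxRootN, ((ν f : Lˣ) : L) ^ (𝔉.N : ℕ) = algebraMap F L y)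
    (haugY : Function.Surjective R.toThetaEnvData.augY)
    (hopen : IsOpenMap fun p : R.toThetaEnvData.PiY => e (R.toThetaEnvData.augY p))
    (Ψ : C ≌ C) (β : Ψ.functor.obj 𝔉.BN ≅ 𝔉.BN) (ΨbiratAut : 𝔉.biratUnits 𝔉.BN ≃* 𝔉.biratUnits 𝔉.BN)
    (hii : 𝔉.PsiAutPreserves Ψ β ΨbiratAut) (ψY : 𝔉.PiX ≃ₜ* 𝔉.PiX)
    (hbase : ∀ g, 𝔉.autBase 𝔉.BN (𝔉.psiAut Ψ β (𝔉.sgpCap (𝔉.ρ g))) = 𝔉.ρ (ψY g))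
    (hψY : 𝔉.PiY.map ψY.toMulEquiv.toMonoidHom = 𝔉.PiY)
    (hψYdd : 𝔉.PiYdd.map ψY.toMulEquiv.toMonoidHom = 𝔉.PiYdd) :
    ∃ (x₃ : 𝔉.PiX) (γ : (𝔉.frdMonoThetaEnv h1 h3 hsec hcs h8 (α.kummerOut hK)).Iso
        (𝔉.frdMonoThetaEnv h1 h3 hsec hcs h8 (α.kummerOut hK))) (k : Aut 𝔉.BN),
      (∀ x, 𝔉.psiAut Ψ β (𝔉.epsilon x) = k * 𝔉.epsilon (γ.e x) * k⁻¹) ∧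
        ∀ x, 𝔉.toPiY (γ.e x) = (ψY.trans (𝔉.conjTop x₃⁻¹)) (𝔉.toPiY x) :=
  exists_monoThetaIso_of_psiAutPreserves h1 h3 hsec hcs h8 (α.kummerOut hK) Ψ β ΨbiratAut hii ψY hbase hψY hψYdd
    (fun hc => α.hDK_kummerOut_of_cor218_i_of_galoisDictionary hK h1 h3 hsec hcs h8 R ι m e j ν H hY h218 hj
      hjN hchi hνμ hνeq hνN haugY hopen hc)

/-- **[EtTh] Theorem 5.10 (iii) as typed (`MonoThetaEnvCompat`) at `DK := kummerOut` FROM THE GALOIS DICTIONARY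
and Cor. 2.18 (i) BY NAME** (rewrap via abc-iut-L2-d4's `monoThetaEnvCompat_of_psiAutPreserves`).
[cite: MochizukiEtTh2009, Thm 5.10 (iii) p.334–335 (PDF pp.108–109); Cor 2.18 (i) p.286 (PDF p.60)] -/
theorem monoThetaEnvCompat_kummerOut_of_cor218_i_of_galoisDictionary [Normal F L]
    [NeZero ((𝔉.N : ℕ) : F)] (H : 𝔉.Facts)
    (hY : 𝔉.IdentifiesPiY R.toThetaEnvData ι.toMulEquiv) (h218 : R.Cor218_i) (hj : Function.Injective j)
    (hjN : ∀ z : Lˣ, z ^ (𝔉.N : ℕ) = 1 → z ∈ j.range)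
    (hchi : ∀ (g : R.G) (x : R.mu), j (R.chi g x) = e g • j x)
    (hνμ : ∀ u : 𝔉.muTorsion 𝔉.BN 𝔉.N, ν ⟨𝔉.muToBirat u, 𝔉.muToBirat_mem_KxRootN u⟩ = j (m u))
    (hνeq : ∀ (f : 𝔉.KxRootN) (y : 𝔉.PiX),
      j (m (α.kummerCocycle hK f (𝔉.sgpCap (𝔉.ρ y)))) * ν f = e (R.aug (ι y)) • ν f)
    (hνN : ∀ y : Fˣ, ∃ f : 𝔉.KxRootN, ((ν f : Lˣ) : L) ^ (𝔉.N : ℕ) = algebraMap F L y)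
    (haugY : Function.Surjective R.toThetaEnvData.augY)
    (hopen : IsOpenMap fun p : R.toThetaEnvData.PiY => e (R.toThetaEnvData.augY p))
    (Ψ : C ≌ C) (β : Ψ.functor.obj 𝔉.BN ≅ 𝔉.BN) (ΨbiratAut : 𝔉.biratUnits 𝔉.BN ≃* 𝔉.biratUnits 𝔉.BN)
    (hii : 𝔉.PsiAutPreserves Ψ β ΨbiratAut) (ψY : 𝔉.PiX ≃ₜ* 𝔉.PiX)
    (hbase : ∀ g, 𝔉.autBase 𝔉.BN (𝔉.psiAut Ψ β (𝔉.sgpCap (𝔉.ρ g))) = 𝔉.ρ (ψY g))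
    (hψY : 𝔉.PiY.map ψY.toMulEquiv.toMonoidHom = 𝔉.PiY)
    (hψYdd : 𝔉.PiYdd.map ψY.toMulEquiv.toMonoidHom = 𝔉.PiYdd) :
    𝔉.MonoThetaEnvCompat h1 h3 hsec hcs h8 (α.kummerOut hK) Ψ β ψY hbase hψY hψYdd :=
  monoThetaEnvCompat_of_psiAutPreserves h1 h3 hsec hcs h8 (α.kummerOut hK) Ψ β ΨbiratAut hii ψY hbase hψY hψYdd
    (fun hc => α.hDK_kummerOut_of_cor218_i_of_galoisDictionary hK h1 h3 hsec hcs h8 R ι m e j ν H hY h218 hj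
      hjN hchi hνμ hνeq hνN haugY hopen hc)

end DictionaryCor218

end BiratAutAction

end ThetaFrobenioid

end Literature.AnabelianGeometry.EtaleTheta
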